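import Mathlib
import Summits.CriticalPhenomena.CardyFormulaZ2.Theorems.CardyMagicRigidityNestingRigidityBondReflection
import Summits.CriticalPhenomena.CardyFormulaZ2.Theorems.CardyMagicRigidityMagicFormulaTCentring
import Literature.Probability.Percolation.PlanarDuality
import Literature.Probability.Percolation.RSW
import Literature.Probability.Percolation.FKLoopNestingIntegrable
import Literature.Probability.Percolation.FKLoopWindingCells
import HarnessLib

/-!
# Crux `NestingRigidity`, line `ring-cloud-tomography` (r5): self-duality of the bond-`ℤ²` loop law and
# the dipole symmetry between all medial cells (keystone K3 `smearedCentring_zEns`, part 2/3)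

Crux `Summit.CriticalPhenomena.CardyFormulaZ2.Theses.CardyMagicRigidity.NestingRigidity`
(stmt-CriticalPhenomena-4835), line `ring-cloud-tomography`, keystone helper K3
`smearedCentring_zEns` (exact untilted first-moment identity on bond-`ℤ²` at `p = 1/2`).  The
centring of a neutral combination of cell nesting counts reduces (dipole decomposition, as on `𝕋` in
`…MagicFormulaTCentring`) to the symmetry `E N_{x∖y} = E N_{y∖x}` of the mean DIPOLE COUNTS
`N_{x∖y} = #{u : W(u,x) ≠ 0, W(u,y) = 0}` between cell centres `x, y`.  On `ℤ²` the open medial cells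
come in two classes (diamonds about the vertices `δℤ²`, diamonds about the plaquette centres
`δ(ℤ+½)²`); same-class pairs are swapped by a point reflection of the lattice (`…BondReflection`,
`integral_ncard_dipole_symm_zEns`, `x + y ∈ δℤ²`).  This file supplies the cross-class pairs:

* §1 SELF-DUALITY at the law level: `dualConfig` preserves `zEns.P = P_{1/2}`
  (`bondPercolation_map_dualConfig_holds` + `symm_half`), as a change of variables for measurable
  statistics; the dipole counts are measurable (`measurable_ncard_dipole`);
* §2 the untyped loop set of `dualConfig ω` is the loop set of `ω` shifted by `δ(1+i)/2` and reversed
  (`mem_loops_dualConfig_iff`, from `MarkovCascadeOneGeneration.mem_bondLoopConfig_dualConfig_iff`);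
  reversal keeps `{W ≠ 0}`, so `N_{x∖y}(dualConfig ω) = N_{(x+p)∖(y+p)}(ω)`, `p = δ(1+i)/2`
  (`ncard_dipole_dualConfig`) and the MEAN dipole counts are invariant under the half-diagonal shift
  (`integral_ncard_dipole_halfShift_zEns`); with the point reflections (general form
  `integral_ncard_dipole_reflect_zEns`): `E N_{x∖y} = E N_{y∖x}` whenever `x + y + p ∈ δℤ²`
  (`integral_ncard_dipole_symm_cross_zEns`);
* §3 registered anchor `dipoleSymmetry_cellCenter_zEns`: `E N_{F∖F'} = E N_{F'∖F}` for ANY two cells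
  `F, F' ∈ ℤ × ℤ` (scaled centres `δ · cellCenter F`), by parity of `F.1 + F.2 + F'.1 + F'.2`.

No definition (`T[b]`, `dip[L, x, y]` are local notations), no cited fact.
-/

noncomputable section

open MeasureTheory Set Filter Metric
open scoped Real Topology BigOperators

namespace Summit.CriticalPhenomena.CardyFormulaZ2.Cruxes.NestingRigidity.RingCloudTomography

open Literature.Probability.RandomPlanarGeometry Literature.Probability.Percolation
  Literature.Probability.LatticeModels
open Summit.CriticalPhenomena.CardyFormulaZ2.Cruxes.NestingRigidity.MarkovCascadeOneGeneration
  (continuous_translate isometry_translate wind_map_translate mem_bondLoopConfig_dualConfig_iff)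

namespace SmearedCentringZ2

/-- The translation `z ↦ z + b` of the plane as a continuous map (local notation). -/
local notation3 "T[" b "]" => (⟨fun z : ℂ ↦ 1 * z + (b : ℂ), continuous_translate b⟩ : C(ℂ, ℂ))

/-- The loops of a family `L` winding around `x` and not around `y` (local notation). -/
local notation3 (prettyPrint := false) "dip[" L ", " x ", " y "]" =>
  {u : UnbasedLoop ℂ | u ∈ (L : Set (UnbasedLoop ℂ)) ∧ u.wind x ≠ 0 ∧ u.wind y = 0}

/-! ## §1 Self-duality of `P_{1/2}` on `ℤ²` -/

/-- **`ω ↦ dualConfig ω` preserves `zEns.P = P_{1/2}`** (`bondPercolation_map_dualConfig_holds`: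
the law of the dual configuration under `P_p` is `P_{1-p}`, and `1 - ½ = ½`). -/
theorem measurePreserving_dualConfig_zEns : MeasurePreserving dualConfig zEns.P zEns.P :=
  ⟨measurable_dualConfig, by
    change (bondPercolation (zdGraph 2) half).map dualConfig = bondPercolation (zdGraph 2) half
    rw [bondPercolation_map_dualConfig_holds half, symm_half]⟩

/-- Change of variables: `∫ F(dualConfig ω) dP = ∫ F dP` for every (a.e. strongly) measurable real
`F` (`dualConfig` is not injective off the lattice configurations, so measurability is asked). -/
theorem integral_comp_dualConfig_zEns {F : BondConfig (Site 2) → ℝ}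
    (hF : AEStronglyMeasurable F zEns.P) :
    ∫ ω, F (dualConfig ω) ∂zEns.P = ∫ ω, F ω ∂zEns.P := by
  change ∫ ω, F (dualConfig ω) ∂(bondPercolation (zdGraph 2) half) =
    ∫ ω, F ω ∂(bondPercolation (zdGraph 2) half)
  have hmap : (bondPercolation (zdGraph 2) half).map dualConfig = bondPercolation (zdGraph 2) half := by
    rw [bondPercolation_map_dualConfig_holds half, symm_half]
  have hF' : AEStronglyMeasurable F ((bondPercolation (zdGraph 2) half).map dualConfig) := by
    rw [hmap]
    exact hF
  rw [← integral_map measurable_dualConfig.aemeasurable hF', hmap]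

/-- **The dipole counts of `zEns` are measurable** (countable index presentation of the loops,
`loops_zEns_eq_image`, `measurable_ncard_image_sep`). -/
theorem measurable_ncard_dipole (δ : ℝ) (x y : ℂ) :
    Measurable fun ω : BondConfig (Site 2) ↦ ((dip[(zEns.X δ ω).loops, x, y]).ncard : ℝ) := by
  have h : Measurable fun ω : BondConfig (Site 2) ↦ (dip[(zEns.X δ ω).loops, x, y]).ncard := by
    simp_rw [loops_zEns_eq_image]
    exact measurable_ncard_image_sep _ measurable_mem_bondIndex _
  exact measurable_from_nat.comp h

/-! ## §2 The loop set of the dual configuration; dipole counts under duality -/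

/-- Translating by `-c` and then by `c` is the identity on unbased loops. -/
theorem map_translate_neg_map_translate (u : UnbasedLoop ℂ) (c : ℂ) :
    (u.map T[-c] (isometry_translate (-c))).map T[c] (isometry_translate c) = u := by
  obtain ⟨ℓ, rfl⟩ := UnbasedLoop.mk_surjective u
  rw [UnbasedLoop.map_mk, UnbasedLoop.map_mk, BasedLoop.map_map]
  have hid : (T[c]).comp T[-c] = ContinuousMap.id ℂ := by
    ext w
    simp
  rw [hid, BasedLoop.map_id]

/-- **The (untyped) loop set of the dual configuration**: `u` is a loop of
`bondLoopConfig δ 0 (dualConfig ω)` iff `u` translated by `δ(1+i)/2` and reversed is a loop of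
`bondLoopConfig δ 0 ω` (`mem_bondLoopConfig_dualConfig_iff`, both types together). -/
theorem mem_loops_dualConfig_iff {δ : ℝ} {ω : BondConfig (Site 2)} (hω : ω ⊆ (zdGraph 2).edgeSet)
    (u : UnbasedLoop ℂ) :
    u ∈ (bondLoopConfig δ 0 (dualConfig ω)).loops ↔
      (u.map T[δ * (1 + Complex.I) / 2] (isometry_translate (δ * (1 + Complex.I) / 2))).reverse ∈
        (bondLoopConfig δ 0 ω).loops := by
  rw [LoopConfig.mem_loops_iff, LoopConfig.mem_loops_iff,
    mem_bondLoopConfig_dualConfig_iff δ ω hω 0 u, mem_bondLoopConfig_dualConfig_iff δ ω hω 1 u,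
    sub_zero, sub_self, or_comm]

/-- **Dipole counts under duality**: the number of loops of the dual configuration winding around
`x` and not around `y` is the number of loops of `ω` winding around `x + δ(1+i)/2` and not around
`y + δ(1+i)/2` (reversal does not change `{W ≠ 0}`). -/
theorem ncard_dipole_dualConfig {δ : ℝ} {ω : BondConfig (Site 2)} (hω : ω ⊆ (zdGraph 2).edgeSet)
    (x y : ℂ) :
    (dip[(bondLoopConfig δ 0 (dualConfig ω)).loops, x, y]).ncard =
      (dip[(bondLoopConfig δ 0 ω).loops, x + δ * (1 + Complex.I) / 2,
        y + δ * (1 + Complex.I) / 2]).ncard := by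
  set p : ℂ := δ * (1 + Complex.I) / 2 with hp
  set Ψ : UnbasedLoop ℂ → UnbasedLoop ℂ := fun u ↦ (u.map T[p] (isometry_translate p)).reverse with hΨ
  have hwind : ∀ (u : UnbasedLoop ℂ) (z : ℂ), (Ψ u).wind (z + p) = -u.wind z := fun u z ↦ by
    rw [hΨ, UnbasedLoop.wind_reverse, wind_map_translate]
  have hinj : Function.Injective Ψ := fun u v h ↦ by
    have h' := congrArg UnbasedLoop.reverse h
    simp only [hΨ, UnbasedLoop.reverse_reverse] at h'
    exact BondTranslation.map_translate_injective p h'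
  have hsurj : ∀ v : UnbasedLoop ℂ, Ψ ((v.map T[-p] (isometry_translate (-p))).reverse) = v := fun v ↦ by
    simp only [hΨ]
    rw [← UnbasedLoop.reverse_map, UnbasedLoop.reverse_reverse, map_translate_neg_map_translate]
  have himage : Ψ '' dip[(bondLoopConfig δ 0 (dualConfig ω)).loops, x, y] =
      dip[(bondLoopConfig δ 0 ω).loops, x + p, y + p] := by
    ext v
    constructor
    · rintro ⟨u, ⟨hu, hx, hy⟩, rfl⟩
      refine ⟨(mem_loops_dualConfig_iff hω u).1 hu, ?_, ?_⟩
      · rw [hwind]; exact neg_ne_zero.2 hx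
      · rw [hwind, hy, neg_zero]
    · rintro ⟨hv, hx, hy⟩
      refine ⟨(v.map T[-p] (isometry_translate (-p))).reverse, ⟨?_, ?_, ?_⟩, hsurj v⟩
      · refine (mem_loops_dualConfig_iff hω _).2 ?_
        change Ψ ((v.map T[-p] (isometry_translate (-p))).reverse) ∈ (bondLoopConfig δ 0 ω).loops
        rw [hsurj]
        exact hv
      · have h := hwind ((v.map T[-p] (isometry_translate (-p))).reverse) x
        rw [hsurj] at h
        intro h0
        rw [h0, neg_zero] at h
        exact hx h
      · have h := hwind ((v.map T[-p] (isometry_translate (-p))).reverse) y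
        rw [hsurj, hy] at h
        exact neg_eq_zero.1 h.symm
  rw [← himage, Set.ncard_image_of_injective _ hinj]

/-- **The mean dipole counts of `zEns` are invariant under the half-diagonal shift `δ(1+i)/2`**
(self-duality of `P_{1/2}` + the loop set of the dual configuration):
`E #{u : W(u,x) ≠ 0, W(u,y) = 0} = E #{u : W(u, x + δ(1+i)/2) ≠ 0, W(u, y + δ(1+i)/2) = 0}`. -/
theorem integral_ncard_dipole_halfShift_zEns (δ : ℝ) (x y : ℂ) :
    ∫ ω, ((dip[(zEns.X δ ω).loops, x, y]).ncard : ℝ) ∂zEns.P =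
      ∫ ω, ((dip[(zEns.X δ ω).loops, x + δ * (1 + Complex.I) / 2,
        y + δ * (1 + Complex.I) / 2]).ncard : ℝ) ∂zEns.P := by
  rw [← integral_comp_dualConfig_zEns (measurable_ncard_dipole δ x y).aestronglyMeasurable]
  refine integral_congr_ae ?_
  change ∀ᵐ ω ∂(bondPercolation (zdGraph 2) half), _
  filter_upwards [ae_subset_edgeSet (zdGraph 2) half] with ω hω
  change ((dip[(bondLoopConfig δ 0 (dualConfig ω)).loops, x, y]).ncard : ℝ) =
    ((dip[(bondLoopConfig δ 0 ω).loops, x + δ * (1 + Complex.I) / 2, y + δ * (1 + Complex.I) / 2]).ncard : ℝ)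
  rw [ncard_dipole_dualConfig hω x y]

/-- **The mean dipole counts of `zEns` are invariant under the point reflections `z ↦ −z + δc`**
(general form of `BondReflection.integral_ncard_dipole_symm_zEns`). -/
theorem integral_ncard_dipole_reflect_zEns (δ : ℝ) (c : Site 2) (x y : ℂ) :
    ∫ ω, ((dip[(zEns.X δ ω).loops, x, y]).ncard : ℝ) ∂zEns.P =
      ∫ ω, ((dip[(zEns.X δ ω).loops, -1 * x + meshPoint δ c, -1 * y + meshPoint δ c]).ncard : ℝ)
        ∂zEns.P := by
  rw [← BondReflection.integral_comp_relabel_reflect_zEns c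
    fun ω ↦ ((dip[(zEns.X δ ω).loops, x, y]).ncard : ℝ)]
  refine integral_congr_ae (Eventually.of_forall fun ω ↦ ?_)
  simp only [BondReflection.loops_zEns_relabel_reflect, BondReflection.ncard_dipole_map_pointReflect]

/-- **CROSS-CLASS DIPOLE SYMMETRY on `ℤ²`** (self-duality): for points `x, y` with
`x + y + δ(1+i)/2 ∈ δℤ²` (a vertex and a plaquette centre of `δℤ²`),
`E #{u : W(u,x) ≠ 0, W(u,y) = 0} = E #{u : W(u,y) ≠ 0, W(u,x) = 0}`: shift by `δ(1+i)/2`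
(duality), then reflect through `δc/2` (a lattice symmetry), which lands on the swapped pair. -/
theorem integral_ncard_dipole_symm_cross_zEns (δ : ℝ) (c : Site 2) {x y : ℂ}
    (hxy : x + y + δ * (1 + Complex.I) / 2 = meshPoint δ c) :
    ∫ ω, ((dip[(zEns.X δ ω).loops, x, y]).ncard : ℝ) ∂zEns.P =
      ∫ ω, ((dip[(zEns.X δ ω).loops, y, x]).ncard : ℝ) ∂zEns.P := by
  rw [integral_ncard_dipole_halfShift_zEns δ x y, integral_ncard_dipole_reflect_zEns δ c]
  have hx : -1 * (x + δ * (1 + Complex.I) / 2) + meshPoint δ c = y := by rw [← hxy]; ring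
  have hy : -1 * (y + δ * (1 + Complex.I) / 2) + meshPoint δ c = x := by rw [← hxy]; ring
  rw [hx, hy]

/-- **DIPOLE SYMMETRY BETWEEN ANY TWO MEDIAL CELL CENTRES of `δℤ²`**: for cells `F, F' ∈ ℤ × ℤ`
with scaled centres `δ c_F`, `δ c_{F'}`, `E N_{F∖F'} = E N_{F'∖F}` — same-class pairs by the point
reflection through the midpoint (`BondReflection.integral_ncard_dipole_symm_zEns`), cross-class
pairs by self-duality (`integral_ncard_dipole_symm_cross_zEns`). -/
theorem integral_ncard_dipole_symm_cellCenter_zEns (δ : ℝ) (F F' : ℤ × ℤ) :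
    ∫ ω, ((dip[(zEns.X δ ω).loops, (δ : ℂ) * cellCenter F, (δ : ℂ) * cellCenter F']).ncard : ℝ) ∂zEns.P =
      ∫ ω, ((dip[(zEns.X δ ω).loops, (δ : ℂ) * cellCenter F', (δ : ℂ) * cellCenter F]).ncard : ℝ)
        ∂zEns.P := by
  rcases Int.emod_two_eq_zero_or_one (F.1 + F.2 + F'.1 + F'.2) with h2 | h2
  · -- same class: `x + y ∈ δℤ²`
    obtain ⟨k, hk⟩ : ∃ k, F.1 - F.2 + F'.1 - F'.2 + 2 = 2 * k := ⟨(F.1 - F.2 + F'.1 - F'.2 + 2) / 2, by omega⟩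
    obtain ⟨l, hl⟩ : ∃ l, F.1 + F.2 + F'.1 + F'.2 + 2 = 2 * l := ⟨(F.1 + F.2 + F'.1 + F'.2 + 2) / 2, by omega⟩
    refine BondReflection.integral_ncard_dipole_symm_zEns δ ![k, l] ?_
    have hk' : (F.1 : ℝ) - F.2 + F'.1 - F'.2 + 2 = 2 * k := by exact_mod_cast hk
    have hl' : (F.1 : ℝ) + F.2 + F'.1 + F'.2 + 2 = 2 * l := by exact_mod_cast hl
    apply Complex.ext
    · simp [cellCenter, meshPoint_re]
      linear_combination (δ / 2) * hk'
    · simp [cellCenter, meshPoint_im]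
      linear_combination (δ / 2) * hl'
  · -- cross class: `x + y + δ(1+i)/2 ∈ δℤ²`
    obtain ⟨k, hk⟩ : ∃ k, F.1 - F.2 + F'.1 - F'.2 + 3 = 2 * k := ⟨(F.1 - F.2 + F'.1 - F'.2 + 3) / 2, by omega⟩
    obtain ⟨l, hl⟩ : ∃ l, F.1 + F.2 + F'.1 + F'.2 + 3 = 2 * l := ⟨(F.1 + F.2 + F'.1 + F'.2 + 3) / 2, by omega⟩
    refine integral_ncard_dipole_symm_cross_zEns δ ![k, l] ?_
    have hk' : (F.1 : ℝ) - F.2 + F'.1 - F'.2 + 3 = 2 * k := by exact_mod_cast hk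
    have hl' : (F.1 : ℝ) + F.2 + F'.1 + F'.2 + 3 = 2 * l := by exact_mod_cast hl
    apply Complex.ext
    · simp [cellCenter, meshPoint_re]
      linear_combination (δ / 2) * hk'
    · simp [cellCenter, meshPoint_im]
      linear_combination (δ / 2) * hl'

end SmearedCentringZ2

open SmearedCentringZ2 in
/-- **DIPOLE SYMMETRY BETWEEN ANY TWO MEDIAL CELLS OF `δℤ²`** (registered helper toward keystone K3
`smearedCentring_zEns`, line `ring-cloud-tomography` r5; the whole lattice-symmetry input of the
exact centring on bond-`ℤ²`).  For every mesh `δ` and cells `F, F' ∈ ℤ × ℤ` of the medial lattice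
(scaled centres `δ c_F`, `δ c_{F'}`: vertices of `δℤ²` or plaquette centres), the mean number of loops
of `zEns` winding around `δ c_F` but not `δ c_{F'}` equals the mean number winding around `δ c_{F'}`
but not `δ c_F`: same-class pairs by the point reflection of `ℤ²` through the midpoint
(`…BondReflection`), vertex-versus-plaquette pairs by SELF-DUALITY of `P_{1/2}` (the loop set of the
dual configuration is the loop set shifted by `δ(1+i)/2` and reversed, `…BondDuality`) followed by a
point reflection. -/
theorem dipoleSymmetry_cellCenter_zEns : ∀ (δ : ℝ) (F F' : ℤ × ℤ),
    ∫ ω, ({u ∈ (zEns.X δ ω).loops | u.wind ((δ : ℂ) * cellCenter F) ≠ 0 ∧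
        u.wind ((δ : ℂ) * cellCenter F') = 0}.ncard : ℝ) ∂zEns.P =
      ∫ ω, ({u ∈ (zEns.X δ ω).loops | u.wind ((δ : ℂ) * cellCenter F') ≠ 0 ∧
        u.wind ((δ : ℂ) * cellCenter F) = 0}.ncard : ℝ) ∂zEns.P :=
  fun δ F F' ↦ integral_ncard_dipole_symm_cellCenter_zEns δ F F'

end Summit.CriticalPhenomena.CardyFormulaZ2.Cruxes.NestingRigidity.RingCloudTomography

end
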